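/-
COR-CM (cell pub-hodgecm2, stage 2 of the Hodge ladder) — TRANSPOSITION SURGE, item (vi) pinning record, binder `hComp`
(REACH half), TEAM hComp (sequel of row U1⁺′ `HComp/PiecesOfRecord.lean`, p304035): CONSERVATIVITY of the v5 clause (F2c)
`pieces` of the named fact `UnitaryCanonicalModel.exists_recordSystem` — the v5 statement FOLLOWS from its v4 shape (no `pieces`).
Seat prover-pub-hodgecm2-hcomp-compare-2-0 (`hcomp-compare-2`).  THEOREMS ONLY: no definition, no instance, no named fact, nothing
asserted; every landed file untouched.  FRAMING: HC_CM is NOT proved; nothing here discharges `hComp`/`hUnif` or the named fact.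
-/
import Summits.HodgeConjecture.CorCM.B01.Transposition.HComp.PiecesOfRecord
import HarnessLib

/-!
# `exists_recordSystem` (v5, with `pieces`) follows from its `pieces`-free (v4) shape

The named fact `UnitaryCanonicalModel.exists_recordSystem` ([Deligne 1979] 2.2.5 + Cor. 2.7.21, Milne 12.8/12.10/14.15–14.17;
tree `UnitaryShimuraCanonicalModel.lean`, v5 = p300664) posits, below one small level `K₀`, a `RecordSystem`: (F1) models `M_K`
smooth projective over `L`, (F2a) `pts`, transition clause `map_pts`, (F2b) `hol`, (F2c) `pieces`, (F3) `recip`.  This file proves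
that the clause (F2c) carries NO ADDITIONAL ASSUMPTION: from data satisfying the OTHER clauses (the v4 shape of the record,
p300116/p300252) one obtains a full v5 `RecordSystem` — `pieces` being the theorem `HComp.exists_pieces_of_components` /
`Record.exists_pieces` of `PiecesOfRecord.lean` (component extraction + per-piece ball datum + base change), and the hermitian
symmetry of `H`, which that theorem consumes, being itself a consequence of the frame hypothesis `Tᴴ H^τ T = diag(1,1,-1)` of the
named fact (`hermitian_of_formCongr`).  Hence the v5 named fact is implied by — in fact equivalent to — its v4 shape
(`exists_recordSystem_of_fields`): the STRONGER-THAN-PRINT question for the cite is the same for v4 and v5.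

* `conjTranspose_J`, `isHermitian_map_of_formCongr`, `hermitian_of_formCongr` — `Tᴴ H^τ T = J` forces `c(H_{ij}) = H_{ji}`;
* `exists_pieces_of_fields` — the v5 `pieces` shape from v4-style FIELDS `(M, smooth, projective, pts, hol)` at one level;
* `nonempty_recordSystem_of_fields` — a v5 `RecordSystem L H τ T hT K₀` from v4-style system fields;
* `exists_recordSystem_of_fields` — the v4-SHAPED existence statement implies `exists_recordSystem` (v5).

0 hypothesis binders of Prop-valued named facts in the first three; the last has ONE (the v4-shaped statement) and concludes the
v5 named fact (T5: a single binder, n/a).  References: P. Deligne, *Variétés de Shimura* (1979) 2.1.2, 2.2.5, Cor. 2.7.21;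
J. S. Milne, *Introduction to Shimura varieties* (2005) Lemma 5.13, Def. 12.8, 12.10; N. Bergeron, J. Millson, C. Moeglin, Acta Math.
216 (2016) Part 2 §1.1 (the hermitian Gram matrix and its Sylvester frame).
-/

set_option autoImplicit false

noncomputable section

open scoped Matrix Topology ComplexOrder
open Set Function MulAction Matrix NumberField CategoryTheory CategoryTheory.Limits AlgebraicGeometry Opposite
open Literature.Geometry.ComplexHyperbolic
open Literature.Geometry.ComplexHyperbolic.BallModel (U21 Ball proj lift mat x₀)
open Literature.NumberTheory.Automorphic
open Literature.NumberTheory.Automorphic.UnitaryGroup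
open Literature.NumberTheory.Automorphic.ShimuraDissection (CosetSpace)
open Literature.AlgebraicGeometry.ShimuraVarieties (negCone hermForm UnitaryBallUniformisationDatum IsCongruenceSubgroup)
open Literature.AlgebraicGeometry.ShimuraVarieties.UnitaryCanonicalModel
open Literature.AlgebraicGeometry.Motives (SchemeOver ComplexPoints AlgPoints IsSmoothProjective IsProjectiveOver baseChangeHom)
open Literature.NumberTheory.Automorphic.Liu2021.AppendixC (C5.OpenCompactSubgroup C5.SmallLevel)

namespace Summit.HodgeConjecture.CorCM.HComp

variable (L : Type) [Field L] [NumberField L] [IsCMField L] (H : Matrix (Fin 3) (Fin 3) L)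
  (τ : L →+* ℂ) (T : GL (Fin 3) ℂ) (hT : formCongr (starRingEnd ℂ) T (H.map τ) = BallModel.J)

/-! ## 1. The frame forces hermitian symmetry -/

/-- `J = diag(1,1,-1)` is hermitian. [folklore] -/
theorem conjTranspose_J : (BallModel.J)ᴴ = BallModel.J := by
  ext i j
  fin_cases i <;> fin_cases j <;> simp [BallModel.J, Matrix.conjTranspose_apply, Matrix.diagonal]

omit [NumberField L] [IsCMField L] in
include hT in
/-- A framed complex Gram matrix is hermitian: `Tᴴ H^τ T = J` with `J` hermitian and `T` invertible gives `(H^τ)ᴴ = H^τ`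
(`H^τ = T⁻ᴴ J T⁻¹`, `FramedCone.hc_eq`). [cite: BergeronMillsonMoeglin2016Balls, Part 2 §1.1] -/
theorem isHermitian_map_of_formCongr : (H.map τ)ᴴ = H.map τ := by
  have hJ := frame_J_of_formCongr L H τ T hT
  have h := FramedCone.hc_eq T hJ
  rw [h, conjTranspose_mul, conjTranspose_mul, conjTranspose_conjTranspose, conjTranspose_J, Matrix.mul_assoc]

include hT in
/-- **The frame hypothesis of `exists_recordSystem` forces `H` to be hermitian for the CM conjugation**: `c(H_{ij}) = H_{ji}`
(apply `τ`, injective, with `τ ∘ c = conj ∘ τ`, Mathlib `IsCMField.complexEmbedding_complexConj`, to `(H^τ)ᴴ = H^τ`).  So the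
hypothesis `hH` of `Record.exists_pieces` is not an extra assumption on the named fact's data.
[cite: BergeronMillsonMoeglin2016Balls, Part 2 §1.1] -/
theorem hermitian_of_formCongr (i j : Fin 3) : cmConjRingHom L (H i j) = H j i := by
  have h := isHermitian_map_of_formCongr L H τ T hT
  have hij := congr_fun (congr_fun h j) i
  simp only [conjTranspose_apply, Matrix.map_apply, Complex.star_def] at hij
  apply τ.injective
  rw [cmConjRingHom_apply, IsCMField.complexEmbedding_complexConj, hij]

/-! ## 2. The pieces from v4-style fields (one level) -/

variable (K : Subgroup (finAdelic (↥(maximalRealSubfield L)) L (IsCMField.complexConj L) 3 H))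

/-- **(F2c) from v4-style FIELDS.**  For an `L`-scheme `M` smooth of relative dimension `2` and projective, a homeomorphism
`pts : M(ℂ)_{along τ} ≃ₜ Sh_K(ℂ)` and the clause `hol` of the record (the data of a v4 `Record L H τ T hT K`, WITHOUT `pieces`),
under the hypotheses of `exists_recordSystem` (frame `hT`, positivity, anisotropy, `K` compact open with torsion-free conjugate
arithmetic levels), the v5 `pieces` statement holds — `Record.exists_pieces` with its fields as binders and `hH` discharged by
`hermitian_of_formCongr`. [cite: Deligne1979ShimuraVarieties, §2.1.2–2.1.3 and 2.2.5] [cite: Milne2005ShimuraVarieties, Lemma 5.13] -/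
theorem exists_pieces_of_fields
    (hanis : ∀ v : Fin 3 → L, hermForm (cmConjRingHom L) H v v = 0 → v = 0)
    (hpos : ∀ τ' : L →+* ℂ, InfinitePlace.mk τ' ≠ InfinitePlace.mk τ → (H.map τ').PosDef)
    (hKc : IsCompact (K : Set (finAdelic (↥(maximalRealSubfield L)) L (IsCMField.complexConj L) 3 H)))
    (hKo : IsOpen (K : Set (finAdelic (↥(maximalRealSubfield L)) L (IsCMField.complexConj L) 3 H)))
    (htf : ∀ g : finAdelic (↥(maximalRealSubfield L)) L (IsCMField.complexConj L) 3 H,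
      ∀ γ ∈ arithmeticLevel (↥(maximalRealSubfield L)) L (IsCMField.complexConj L) 3 H
        (K.map (MulAut.conj g).toMonoidHom), IsOfFinOrder γ → γ = 1)
    (M : SchemeOver L) [hsm : SmoothOfRelativeDimension 2 M.hom] (hpr : IsProjectiveOver M)
    (pts : letI : Algebra L ℂ := τ.toAlgebra
      ComplexPoints M ≃ₜ ShimuraSet L H τ T hT K)
    (hol : letI : Algebra L ℂ := τ.toAlgebra
      ∀ a : finAdelic (↥(maximalRealSubfield L)) L (IsCMField.complexConj L) 3 H,
        ∃ u : (Fin 3 → ℂ) → ComplexPoints ((baseChangeHom τ).obj M),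
          (∀ x : Ball, u ((T : Matrix (Fin 3) (Fin 3) ℂ) *ᵥ BallModel.lift x) =
              AlgPoints.baseChangeEquiv τ M (pts.symm (ShimuraSet.mk L H τ T hT K x a))) ∧
          (∀ v ∈ negCone (H.map τ), ∀ c : ℂ, c ≠ 0 → u (c • v) = u v) ∧
          ∀ (U : ((baseChangeHom τ).obj M).left.affineOpens)
            (f : ((baseChangeHom τ).obj M).left.presheaf.obj (op (↑U : ((baseChangeHom τ).obj M).left.Opens))),
            DifferentiableOn ℂ
              (fun v ↦ AlgPoints.evalOrZero (↑U : ((baseChangeHom τ).obj M).left.Opens) f (u v))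
              (negCone (H.map τ) ∩ u ⁻¹' {P | P.pt ∈ (↑U : ((baseChangeHom τ).obj M).left.Opens)})) :
    letI : Algebra L ℂ := τ.toAlgebra
    ∃ (g : orbitRel.Quotient (rational (↥(maximalRealSubfield L)) L (IsCMField.complexConj L) 3 H)
          (CosetSpace (rationalToFinAdelic (↥(maximalRealSubfield L)) L (IsCMField.complexConj L) 3 H) K) →
        finAdelic (↥(maximalRealSubfield L)) L (IsCMField.complexConj L) 3 H)
      (_ : ∀ q, Quotient.mk'' (CosetSpace.pt (rationalToFinAdelic _ L _ 3 H) K (g q)) = q)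
      (X : orbitRel.Quotient (rational (↥(maximalRealSubfield L)) L (IsCMField.complexConj L) 3 H)
          (CosetSpace (rationalToFinAdelic (↥(maximalRealSubfield L)) L (IsCMField.complexConj L) 3 H) K) →
        SchemeOver ℂ)
      (ι : ∀ q, X q ⟶ (baseChangeHom τ).obj M)
      (_ : IsColimit (Cofan.mk ((baseChangeHom τ).obj M) ι))
      (B : ∀ q, UnitaryBallUniformisationDatum 2 (X q)),
      ∀ q, (B q).Hℂ = H.map τ ∧
        (B q).Γ.map (Matrix.GeneralLinearGroup.map ((B q).τ₁ : ↥(B q).E →+* ℂ)) =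
          (arithmeticLevel (↥(maximalRealSubfield L)) L (IsCMField.complexConj L) 3 H
            (K.map (MulAut.conj (g q)).toMonoidHom)).map (Matrix.GeneralLinearGroup.map τ) ∧
        ∀ x : Ball, AlgPoints.map (ι q) ((B q).unif ((T : Matrix (Fin 3) (Fin 3) ℂ) *ᵥ BallModel.lift x)) =
          AlgPoints.baseChangeEquiv τ M (pts.symm (ShimuraSet.mk L H τ T hT K x (g q))) := by
  classical
  letI : Algebra L ℂ := τ.toAlgebra
  have hH : ∀ i j, cmConjRingHom L (H i j) = H j i := hermitian_of_formCongr L H τ T hT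
  -- (F1) under base change
  haveI : SmoothOfRelativeDimension 2 ((baseChangeHom τ).obj M).hom :=
    Literature.AlgebraicGeometry.HodgeTheory.smoothOfRelativeDimension_baseChangeHom_hom τ 2 M
  have hprC : IsProjectiveOver ((baseChangeHom τ).obj M) := hpr.baseChange_obj ℂ
  -- (F2a) moved to the complex fibre
  let b : ComplexPoints M ≃ₜ ComplexPoints ((baseChangeHom τ).obj M) :=
    Homeomorph.mk (AlgPoints.baseChangeEquiv τ M) (AlgPoints.continuous_baseChangeEquiv τ M)
      (AlgPoints.continuous_baseChangeEquiv_symm τ M)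
  let e : ComplexPoints ((baseChangeHom τ).obj M) ≃ₜ ShimuraSet L H τ T hT K := b.symm.trans pts
  have he : ∀ (z : Ball) (a : finAdelic (↥(maximalRealSubfield L)) L (IsCMField.complexConj L) 3 H),
      e.symm (ShimuraSet.mk L H τ T hT K z a) =
        AlgPoints.baseChangeEquiv τ M (pts.symm (ShimuraSet.mk L H τ T hT K z a)) := fun _ _ => rfl
  -- representatives
  have hrep : ∀ q : orbitRel.Quotient (rational (↥(maximalRealSubfield L)) L (IsCMField.complexConj L) 3 H)
      (CosetSpace (rationalToFinAdelic (↥(maximalRealSubfield L)) L (IsCMField.complexConj L) 3 H) K),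
      ∃ a : finAdelic (↥(maximalRealSubfield L)) L (IsCMField.complexConj L) 3 H,
        Quotient.mk'' (CosetSpace.pt (rationalToFinAdelic _ L _ 3 H) K a) = q := by
    intro q
    induction q using Quotient.inductionOn' with
    | h p =>
      obtain ⟨a, rfl⟩ := CosetSpace.pt_surjective (rationalToFinAdelic _ L _ 3 H) K p
      exact ⟨a, rfl⟩
  choose g hg using hrep
  -- (T2) with colimit, then the pieces from components
  obtain ⟨E, ι, φ, hE, hopen, -, -, -, hφ, -, ⟨hcol⟩⟩ :=
    Literature.AlgebraicGeometry.ShimuraVarieties.Deligne1979.exists_components_homeomorph_ballQuotient_isColimit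
      L H τ T hT K (d := 2) hprC hKo e g hg
  obtain ⟨X', ι', hcol', B, hB⟩ := exists_pieces_of_components L H τ T hT K hH hanis hpos hKc hKo htf
    (fun z a => e.symm (ShimuraSet.mk L H τ T hT K z a))
    (fun a => by
      obtain ⟨u, hu1, hu2, hu3⟩ := hol a
      exact ⟨u, fun x => by rw [hu1 x, he], hu2, hu3⟩)
    g E ι φ hE hopen hφ hcol
  exact ⟨g, hg, X', ι', hcol', B, fun q => ⟨(hB q).1, (hB q).2.1, fun x => by rw [(hB q).2.2 x, he]⟩⟩

/-! ## 3. A v5 `RecordSystem` from v4-style system fields; the v5 named fact from the v4-shaped statement -/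

/-- **A v5 `RecordSystem` (with `pieces`) from v4-style SYSTEM FIELDS** — models `M_K`, smooth/projective, `pts`, `map_pts`,
`hol`, `recip` (the fields of the v4 `RecordSystem`, p300252) — under the hypotheses of `exists_recordSystem` at `K₀`: the field
`pieces` is `exists_pieces_of_fields` at each small level `K` (torsion-freeness descends from `K₀`, `torsionFree_arithmeticLevel_conj_of_le`).
[cite: Deligne1979ShimuraVarieties, §2.1.2–2.1.4 and 2.2.5] [cite: Milne2005ShimuraVarieties, Lemma 5.13 and Def. 12.10] -/
theorem nonempty_recordSystem_of_fields
    {K₀ : C5.OpenCompactSubgroup ↥(finAdelic (↥(maximalRealSubfield L)) L (IsCMField.complexConj L) 3 H)}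
    (hanis : ∀ v : Fin 3 → L, hermForm (cmConjRingHom L) H v v = 0 → v = 0)
    (hpos : ∀ τ' : L →+* ℂ, InfinitePlace.mk τ' ≠ InfinitePlace.mk τ → (H.map τ').PosDef)
    (htf : ∀ g : finAdelic (↥(maximalRealSubfield L)) L (IsCMField.complexConj L) 3 H,
      ∀ γ ∈ arithmeticLevel (↥(maximalRealSubfield L)) L (IsCMField.complexConj L) 3 H
        (K₀.1.map (MulAut.conj g).toMonoidHom), IsOfFinOrder γ → γ = 1)
    (M : C5.SmallLevel K₀ ⥤ SchemeOver L)
    (smooth : ∀ K : C5.SmallLevel K₀, SmoothOfRelativeDimension 2 (M.obj K).hom)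
    (projective : ∀ K : C5.SmallLevel K₀, IsProjectiveOver (M.obj K))
    (pts : letI : Algebra L ℂ := τ.toAlgebra
      ∀ K : C5.SmallLevel K₀, ComplexPoints (M.obj K) ≃ₜ ShimuraSet L H τ T hT K.1.1)
    (map_pts : letI : Algebra L ℂ := τ.toAlgebra
      ∀ (K K' : C5.SmallLevel K₀) (f : K ⟶ K') (z : Ball)
        (a : finAdelic (↥(maximalRealSubfield L)) L (IsCMField.complexConj L) 3 H),
        pts K' (AlgPoints.map (M.map f) ((pts K).symm (ShimuraSet.mk L H τ T hT K.1.1 z a))) =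
          ShimuraSet.mk L H τ T hT K'.1.1 z a)
    (hol : letI : Algebra L ℂ := τ.toAlgebra
      ∀ (K : C5.SmallLevel K₀) (a : finAdelic (↥(maximalRealSubfield L)) L (IsCMField.complexConj L) 3 H),
        ∃ u : (Fin 3 → ℂ) → ComplexPoints ((baseChangeHom τ).obj (M.obj K)),
          (∀ x : Ball, u ((T : Matrix (Fin 3) (Fin 3) ℂ) *ᵥ BallModel.lift x) =
              AlgPoints.baseChangeEquiv τ (M.obj K) ((pts K).symm (ShimuraSet.mk L H τ T hT K.1.1 x a))) ∧
          (∀ v ∈ negCone (H.map τ), ∀ c : ℂ, c ≠ 0 → u (c • v) = u v) ∧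
          ∀ (U : ((baseChangeHom τ).obj (M.obj K)).left.affineOpens)
            (f : ((baseChangeHom τ).obj (M.obj K)).left.presheaf.obj
              (op (↑U : ((baseChangeHom τ).obj (M.obj K)).left.Opens))),
            DifferentiableOn ℂ
              (fun v ↦ AlgPoints.evalOrZero (↑U : ((baseChangeHom τ).obj (M.obj K)).left.Opens) f (u v))
              (negCone (H.map τ) ∩ u ⁻¹' {P | P.pt ∈ (↑U : ((baseChangeHom τ).obj (M.obj K)).left.Opens)}))
    (recip : letI : Algebra L ℂ := τ.toAlgebra
      ∀ (K : C5.SmallLevel K₀) (σ : ℂ ≃ₐ[L] ℂ) (s : (IsDedekindDomain.FiniteAdeleRing (𝓞 L) L)ˣ),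
        IsArtinCorrespondent L τ s σ.toRingEquiv →
        ∀ (v₃ : Fin 3 → L) (x : Ball), IsLinePoint L τ T v₃ x →
          ∀ d : finAdelic (↥(maximalRealSubfield L)) L (IsCMField.complexConj L) 3 H,
            IsDiagTwist L H v₃ (recipFactor L s) d →
            ∀ a : finAdelic (↥(maximalRealSubfield L)) L (IsCMField.complexConj L) 3 H,
              σ • (pts K).symm (ShimuraSet.mk L H τ T hT K.1.1 x a) =
                (pts K).symm (ShimuraSet.mk L H τ T hT K.1.1 x (d * a))) :
    Nonempty (RecordSystem L H τ T hT K₀) :=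
  ⟨{ M := M
     smooth := smooth
     projective := projective
     pts := pts
     map_pts := map_pts
     hol := hol
     pieces := fun K =>
       haveI := smooth K
       exists_pieces_of_fields L H τ T hT K.1.1 hanis hpos K.1.2.2 K.1.2.1
         (torsionFree_arithmeticLevel_conj_of_le K.2 htf) (M.obj K) (projective K) (pts K) (hol K)
     recip := recip }⟩

/-- **The v5 named fact follows from its v4 shape.**  If, for all data `(L, H, τ, T, hT)` with positivity and anisotropy and every
small level `K₀` with torsion-free conjugate arithmetic levels, there are v4-style system fields `(M, smooth, projective, pts,
map_pts, hol, recip)` (the statement of `exists_recordSystem` as it stood at p300252, spelled out field by field), then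
`UnitaryCanonicalModel.exists_recordSystem` (v5, p300664 — the same with the clause `pieces`) holds.  So the v5 cite carries no
assumption beyond the v4 one (CONSERVATIVITY of the `pieces` clause; the converse direction is projection of fields).
[cite: Deligne1979ShimuraVarieties, 2.2.5 and Cor. 2.7.21; 2.1.2–2.1.4] [cite: Milne2005ShimuraVarieties, Def. 12.8 (62) p. 114; Def. 12.10 p. 115] -/
theorem exists_recordSystem_of_fields
    (h : ∀ (L : Type) [Field L] [NumberField L] [IsCMField L] (H : Matrix (Fin 3) (Fin 3) L) (τ : L →+* ℂ)
      (T : GL (Fin 3) ℂ) (hT : formCongr (starRingEnd ℂ) T (H.map τ) = BallModel.J),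
      (∀ τ' : L →+* ℂ, InfinitePlace.mk τ' ≠ InfinitePlace.mk τ → (H.map τ').PosDef) →
      (∀ v : Fin 3 → L, hermForm (cmConjRingHom L) H v v = 0 → v = 0) →
      ∀ K₀ : C5.OpenCompactSubgroup ↥(finAdelic (↥(maximalRealSubfield L)) L (IsCMField.complexConj L) 3 H),
        (∀ g : finAdelic (↥(maximalRealSubfield L)) L (IsCMField.complexConj L) 3 H,
          ∀ γ ∈ arithmeticLevel (↥(maximalRealSubfield L)) L (IsCMField.complexConj L) 3 H
            (K₀.1.map (MulAut.conj g).toMonoidHom), IsOfFinOrder γ → γ = 1) →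
        letI : Algebra L ℂ := τ.toAlgebra
        ∃ (M : C5.SmallLevel K₀ ⥤ SchemeOver L)
          (_ : ∀ K : C5.SmallLevel K₀, SmoothOfRelativeDimension 2 (M.obj K).hom)
          (_ : ∀ K : C5.SmallLevel K₀, IsProjectiveOver (M.obj K))
          (pts : ∀ K : C5.SmallLevel K₀, ComplexPoints (M.obj K) ≃ₜ ShimuraSet L H τ T hT K.1.1),
          (∀ (K K' : C5.SmallLevel K₀) (f : K ⟶ K') (z : Ball)
              (a : finAdelic (↥(maximalRealSubfield L)) L (IsCMField.complexConj L) 3 H),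
              pts K' (AlgPoints.map (M.map f) ((pts K).symm (ShimuraSet.mk L H τ T hT K.1.1 z a))) =
                ShimuraSet.mk L H τ T hT K'.1.1 z a) ∧
          (∀ (K : C5.SmallLevel K₀) (a : finAdelic (↥(maximalRealSubfield L)) L (IsCMField.complexConj L) 3 H),
              ∃ u : (Fin 3 → ℂ) → ComplexPoints ((baseChangeHom τ).obj (M.obj K)),
                (∀ x : Ball, u ((T : Matrix (Fin 3) (Fin 3) ℂ) *ᵥ BallModel.lift x) =
                    AlgPoints.baseChangeEquiv τ (M.obj K) ((pts K).symm (ShimuraSet.mk L H τ T hT K.1.1 x a))) ∧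
                (∀ v ∈ negCone (H.map τ), ∀ c : ℂ, c ≠ 0 → u (c • v) = u v) ∧
                ∀ (U : ((baseChangeHom τ).obj (M.obj K)).left.affineOpens)
                  (f : ((baseChangeHom τ).obj (M.obj K)).left.presheaf.obj
                    (op (↑U : ((baseChangeHom τ).obj (M.obj K)).left.Opens))),
                  DifferentiableOn ℂ
                    (fun v ↦ AlgPoints.evalOrZero (↑U : ((baseChangeHom τ).obj (M.obj K)).left.Opens) f (u v))
                    (negCone (H.map τ) ∩ u ⁻¹' {P | P.pt ∈ (↑U : ((baseChangeHom τ).obj (M.obj K)).left.Opens)})) ∧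
          (∀ (K : C5.SmallLevel K₀) (σ : ℂ ≃ₐ[L] ℂ) (s : (IsDedekindDomain.FiniteAdeleRing (𝓞 L) L)ˣ),
              IsArtinCorrespondent L τ s σ.toRingEquiv →
              ∀ (v₃ : Fin 3 → L) (x : Ball), IsLinePoint L τ T v₃ x →
                ∀ d : finAdelic (↥(maximalRealSubfield L)) L (IsCMField.complexConj L) 3 H,
                  IsDiagTwist L H v₃ (recipFactor L s) d →
                  ∀ a : finAdelic (↥(maximalRealSubfield L)) L (IsCMField.complexConj L) 3 H,
                    σ • (pts K).symm (ShimuraSet.mk L H τ T hT K.1.1 x a) =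
                      (pts K).symm (ShimuraSet.mk L H τ T hT K.1.1 x (d * a)))) :
    exists_recordSystem := by
  intro L _ _ _ H τ T hT hpos hanis K₀ htf
  obtain ⟨M, smooth, projective, pts, map_pts, hol, recip⟩ := h L H τ T hT hpos hanis K₀ htf
  exact nonempty_recordSystem_of_fields L H τ T hT hanis hpos htf M smooth projective pts map_pts hol recip

end Summit.HodgeConjecture.CorCM.HComp

end
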